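import Literature.Probability.Percolation.FourArmGarbanProofs
import Literature.Probability.Percolation.InsertionTolerance
import Literature.Probability.Percolation.PlanarDuality
import Literature.Probability.Percolation.RSW
import HarnessLib

/-!
# The alternating four-arm event of `ℤ²` bond percolation has positive probability

Topic `Literature/Probability/Percolation`, bond percolation on `ℤ² = Site 2` at `p = 1/2`
(`bondPercolation (zdGraph 2) half`), four-arm event in the cluster form of `FourArmGarban.lean`
(`fourArmTwoClusters r R`: two open crossings of the square annulus `A_{r,R} = {r ≤ ‖·‖_∞ ≤ R}`
lying in distinct open clusters of the annulus). Proofs and auxiliary definitions only (no named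
fact): support for the quasi-multiplicativity input of `Garban2011_fourArm_multiscale`
(`FourArmGarbanExtendability.lean`, hypothesis `hRSW`).

Schramm–Steif's quasi-multiplicativity statement for the square grid (Ann. Math. 171 (2010),
App. A, Prop. A.1 = arXiv:math/0504586 Prop. 33: "`P[A_j(r,2r)] > 1/C` if `P[A_j(r,2r)] > 0`
(i.e., if `r` is large enough to allow `j` crossings)") carries a positivity proviso. This file
proves that in the tree's rendering the proviso is always met:

* `real_fourArmTwoClusters_pos` — **`P_{1/2}(fourArmTwoClusters r R) > 0` for all `1 ≤ r ≤ R`**: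
  the configurations containing the two axis segments `{r ≤ |x₀| ≤ R, x₁ = 0}` and no other pair
  of sites of `B(R)` lie in the event (`mem_fourArmTwoClusters_of_axis`: the segments are open
  crossings, and an open path of the annulus from `(r, 0)` can only run along the positive
  segment, so never reaches `(-r, 0)`), and form a cylinder event of probability
  `2^{-|axis edges|} · P(all other pairs of B(R) closed) > 0` (independence of disjoint edge sets).
* auxiliary: `axisSites`, `posAxisEdges`, `negAxisEdges`, the straight axis walks
  `exists_posAxis_walk`, `exists_negAxis_walk`.

## References

* O. Schramm, J. Steif, Ann. of Math. 171 (2010), Appendix A, Prop. A.1 (the proviso)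
  [SchrammSteif2010].
* G. Grimmett, *Percolation*, 2nd ed. (1999), §1.3 (cylinder probabilities of product measure)
  [GrimmettPercolation1999].
-/

noncomputable section

namespace Literature.Probability.Percolation

open _root_.MeasureTheory Set LatticeModels
open scoped Classical

/-! ### The four-arm event has positive probability -/

section Positivity

/-- The sites `{(i, 0) : r ≤ |i| ≤ R}` of the two horizontal axis segments of `A_{r,R}`. [folklore] -/
def axisSites (r R : ℕ) : Set (Site 2) :=
  {x | x 1 = 0 ∧ (r : ℤ) ≤ |x 0| ∧ |x 0| ≤ R}

/-- Membership of an axis point in `axisSites`. [folklore] -/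
theorem pt_mem_axisSites_iff {r R : ℕ} (i : ℤ) :
    pt i 0 ∈ axisSites r R ↔ (r : ℤ) ≤ |i| ∧ |i| ≤ R := by
  simp [axisSites, pt]

/-- The edges `{(i,0),(i+1,0)}`, `r ≤ i < R`, of the positive axis segment, as a `Finset`. [folklore] -/
def posAxisEdges (r R : ℕ) : Finset (Sym2 (Site 2)) :=
  (Finset.Ico r R).image fun i : ℕ => s(pt i 0, pt (i + 1) 0)

/-- The edges `{(-i-1,0),(-i,0)}`, `r ≤ i < R`, of the negative axis segment, as a `Finset`. [folklore] -/
def negAxisEdges (r R : ℕ) : Finset (Sym2 (Site 2)) :=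
  (Finset.Ico r R).image fun i : ℕ => s(pt (-((i : ℤ) + 1)) 0, pt (-(i : ℤ)) 0)

/-- Positive axis edges are lattice edges. [folklore] -/
theorem posAxisEdges_subset_edgeSet (r R : ℕ) :
    (↑(posAxisEdges r R) : Set (Sym2 (Site 2))) ⊆ (zdGraph 2).edgeSet := by
  intro e he
  simp only [posAxisEdges, Finset.coe_image, Set.mem_image] at he
  obtain ⟨i, -, rfl⟩ := he
  rw [SimpleGraph.mem_edgeSet, zdGraph_adj_iff]
  exact ⟨0, Or.inl (by exact_mod_cast pt_succ_eq i 0)⟩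

/-- Negative axis edges are lattice edges. [folklore] -/
theorem negAxisEdges_subset_edgeSet (r R : ℕ) :
    (↑(negAxisEdges r R) : Set (Sym2 (Site 2))) ⊆ (zdGraph 2).edgeSet := by
  intro e he
  simp only [negAxisEdges, Finset.coe_image, Set.mem_image] at he
  obtain ⟨i, -, rfl⟩ := he
  rw [SimpleGraph.mem_edgeSet, zdGraph_adj_iff]
  refine ⟨0, Or.inl ?_⟩
  have := pt_succ_eq (-((i : ℤ) + 1)) 0
  rw [show -((i : ℤ) + 1) + 1 = -(i : ℤ) by ring] at this
  exact this

/-- The straight walk along the positive axis from `(r, 0)` to `(r + k, 0)`. [folklore] -/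
theorem exists_posAxis_walk (r k : ℕ) :
    ∃ p : (zdGraph 2).Walk (pt r 0) (pt (r + k) 0),
      (∀ z ∈ p.support, ∃ j : ℕ, j ≤ k ∧ z = pt (r + j) 0) ∧
      ∀ e ∈ p.edges, ∃ j : ℕ, j < k ∧ e = s(pt (r + j) 0, pt (r + j + 1) 0) := by
  induction k with
  | zero =>
    refine ⟨(SimpleGraph.Walk.nil : (zdGraph 2).Walk (pt r 0) (pt r 0)).copy rfl (by simp),
      fun z hz => ⟨0, le_rfl, ?_⟩, fun e he => ?_⟩
    · simp only [SimpleGraph.Walk.support_copy, SimpleGraph.Walk.support_nil, List.mem_singleton] at hz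
      rw [hz]; simp
    · rw [SimpleGraph.Walk.edges_copy, SimpleGraph.Walk.edges_nil] at he
      exact absurd he List.not_mem_nil
  | succ k ih =>
    obtain ⟨p, hs, he⟩ := ih
    have hadj : (zdGraph 2).Adj (pt (r + k) 0) (pt (r + (k + 1)) 0) := by
      rw [zdGraph_adj_iff]
      refine ⟨0, Or.inl ?_⟩
      have := pt_succ_eq ((r : ℤ) + k) 0
      rw [add_assoc] at this
      exact_mod_cast this
    refine ⟨p.concat hadj, fun z hz => ?_, fun e he' => ?_⟩
    · rw [SimpleGraph.Walk.support_concat, List.mem_append, List.mem_singleton] at hz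
      rcases hz with hz | rfl
      · obtain ⟨j, hj, rfl⟩ := hs z hz
        exact ⟨j, by omega, rfl⟩
      · exact ⟨k + 1, le_rfl, rfl⟩
    · rw [SimpleGraph.Walk.edges_concat, List.concat_eq_append, List.mem_append,
        List.mem_singleton] at he'
      rcases he' with he' | rfl
      · obtain ⟨j, hj, rfl⟩ := he e he'
        exact ⟨j, by omega, rfl⟩
      · exact ⟨k, by omega, by push_cast; rw [← add_assoc]⟩

/-- The straight walk along the negative axis from `(-r, 0)` to `(-(r + k), 0)`. [folklore] -/
theorem exists_negAxis_walk (r k : ℕ) :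
    ∃ p : (zdGraph 2).Walk (pt (-(r : ℤ)) 0) (pt (-((r : ℤ) + k)) 0),
      (∀ z ∈ p.support, ∃ j : ℕ, j ≤ k ∧ z = pt (-((r : ℤ) + j)) 0) ∧
      ∀ e ∈ p.edges, ∃ j : ℕ, j < k ∧ e = s(pt (-((r : ℤ) + j + 1)) 0, pt (-((r : ℤ) + j)) 0) := by
  induction k with
  | zero =>
    refine ⟨(SimpleGraph.Walk.nil : (zdGraph 2).Walk (pt (-(r : ℤ)) 0) (pt (-(r : ℤ)) 0)).copy rfl
      (by push_cast; ring_nf), fun z hz => ⟨0, le_rfl, ?_⟩, fun e he => ?_⟩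
    · simp only [SimpleGraph.Walk.support_copy, SimpleGraph.Walk.support_nil, List.mem_singleton] at hz
      rw [hz]; push_cast; ring_nf
    · rw [SimpleGraph.Walk.edges_copy, SimpleGraph.Walk.edges_nil] at he
      exact absurd he List.not_mem_nil
  | succ k ih =>
    obtain ⟨p, hs, he⟩ := ih
    have hadj : (zdGraph 2).Adj (pt (-((r : ℤ) + k)) 0) (pt (-((r : ℤ) + (k + 1 : ℕ))) 0) := by
      rw [zdGraph_adj_iff]
      refine ⟨0, Or.inr ?_⟩
      have := pt_succ_eq (-((r : ℤ) + (k + 1 : ℕ))) 0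
      push_cast at this ⊢
      rw [show -((r : ℤ) + (k + 1)) + 1 = -((r : ℤ) + k) by ring] at this
      exact this
    refine ⟨p.concat hadj, fun z hz => ?_, fun e he' => ?_⟩
    · rw [SimpleGraph.Walk.support_concat, List.mem_append, List.mem_singleton] at hz
      rcases hz with hz | rfl
      · obtain ⟨j, hj, rfl⟩ := hs z hz
        exact ⟨j, by omega, rfl⟩
      · exact ⟨k + 1, le_rfl, rfl⟩
    · rw [SimpleGraph.Walk.edges_concat, List.concat_eq_append, List.mem_append,
        List.mem_singleton] at he'
      rcases he' with he' | rfl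
      · obtain ⟨j, hj, rfl⟩ := he e he'
        exact ⟨j, by omega, rfl⟩
      · refine ⟨k, by omega, ?_⟩
        rw [Sym2.eq_swap]
        push_cast; ring_nf

/-- **The configuration "only the axis segments" realises the four-arm event.** If a lattice
configuration `ω` contains the positive and negative axis edges of `A_{r,R}` and every other pair
of sites of `B(R)` is closed, then `ω ∈ fourArmTwoClusters r R` (`1 ≤ r ≤ R`): the two segments
are open crossings, and an open path of the annulus from `(r,0)` can only run along the positive
segment, so never reaches `(-r, 0)`. [folklore] -/
theorem mem_fourArmTwoClusters_of_axis {r R : ℕ} (hr : 1 ≤ r) (hrR : r ≤ R)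
    {ω : BondConfig (Site 2)} (hω : ω ⊆ (zdGraph 2).edgeSet)
    (hpos : (↑(posAxisEdges r R) : Set (Sym2 (Site 2))) ⊆ ω)
    (hneg : (↑(negAxisEdges r R) : Set (Sym2 (Site 2))) ⊆ ω)
    (hclosed : ∀ e ∈ (box 2 R).sym2, e ∈ ω → ∀ x ∈ e, x ∈ axisSites r R) :
    ω ∈ fourArmTwoClusters r R := by
  -- membership facts
  have hann : ∀ (i : ℤ), (r : ℤ) ≤ |i| → |i| ≤ R → pt i 0 ∈ sqAnnulus r R := fun i h1 h2 => by
    rw [mem_sqAnnulus_iff hr]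
    refine ⟨fun k => ?_, ⟨0, ?_⟩⟩
    · fin_cases k
      · show -(R : ℤ) ≤ i ∧ i ≤ R
        constructor <;> linarith [abs_le.1 h2 |>.1, abs_le.1 h2 |>.2]
      · show -(R : ℤ) ≤ 0 ∧ (0 : ℤ) ≤ R
        constructor <;> linarith
    · show (r : ℤ) ≤ i ∨ i ≤ -(r : ℤ)
      rcases le_abs'.1 h1 with h | h
      · exact Or.inr h
      · exact Or.inl h
  have hsph : ∀ (i : ℤ) (m : ℕ), 1 ≤ m → |i| = m → pt i 0 ∈ siteSphere m := fun i m hm h => by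
    rw [mem_siteSphere_iff hm]
    refine ⟨fun k => ?_, ⟨0, ?_⟩⟩
    · fin_cases k
      · show -(m : ℤ) ≤ i ∧ i ≤ m
        constructor <;> linarith [abs_le.1 h.le |>.1, abs_le.1 h.le |>.2]
      · show -(m : ℤ) ≤ 0 ∧ (0 : ℤ) ≤ m
        constructor <;> linarith
    · show (m : ℤ) ≤ i ∨ i ≤ -(m : ℤ)
      rcases le_abs'.1 h.ge with h' | h'
      · exact Or.inr h'
      · exact Or.inl h'
  have hR : 1 ≤ R := le_trans hr hrR
  -- the two crossings
  obtain ⟨p₁, hp₁s, hp₁e⟩ := exists_posAxis_walk r (R - r)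
  obtain ⟨p₂, hp₂s, hp₂e⟩ := exists_negAxis_walk r (R - r)
  have hRr : (r : ℤ) + ((R - r : ℕ) : ℤ) = R := by push_cast [Nat.cast_sub hrR]; ring
  have h₁ : ω ∈ openConnIn (sqAnnulus r R) (pt r 0) (pt R 0) := by
    have := mem_openConnIn_of_walk (S := sqAnnulus r R) (ω := ω) p₁ (fun z hz => ?_) (fun e he => ?_)
    · convert this using 3; rw [hRr]
    · obtain ⟨j, hj, rfl⟩ := hp₁s z hz
      exact hann _ (by rw [abs_of_nonneg (by positivity)]; linarith)
        (by rw [abs_of_nonneg (by positivity)]; omega)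
    · obtain ⟨j, hj, rfl⟩ := hp₁e e he
      apply hpos
      simp only [posAxisEdges, Finset.coe_image, Finset.coe_Ico, Set.mem_image, Set.mem_Ico]
      exact ⟨r + j, ⟨by omega, by omega⟩, by push_cast; ring_nf⟩
  have h₂ : ω ∈ openConnIn (sqAnnulus r R) (pt (-(r : ℤ)) 0) (pt (-(R : ℤ)) 0) := by
    have hRr' : -((r : ℤ) + (R - r : ℕ)) = -(R : ℤ) := by omega
    have := mem_openConnIn_of_walk (S := sqAnnulus r R) (ω := ω) p₂ (fun z hz => ?_) (fun e he => ?_)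
    · convert this using 2; rw [hRr']
    · obtain ⟨j, hj, rfl⟩ := hp₂s z hz
      exact hann _ (by rw [abs_of_nonpos (by linarith)]; linarith)
        (by rw [abs_of_nonpos (by linarith)]; omega)
    · obtain ⟨j, hj, rfl⟩ := hp₂e e he
      apply hneg
      simp only [negAxisEdges, Finset.coe_image, Finset.coe_Ico, Set.mem_image, Set.mem_Ico]
      exact ⟨r + j, ⟨by omega, by omega⟩, by push_cast; ring_nf⟩
  refine ⟨pt r 0, hsph r r hr (by rw [abs_of_nonneg (by positivity)]), pt (-(r : ℤ)) 0,
    hsph _ r hr (by rw [abs_neg, abs_of_nonneg (by positivity)]), pt R 0,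
    hsph R R hR (by rw [abs_of_nonneg (by positivity)]), pt (-(R : ℤ)) 0,
    hsph _ R hR (by rw [abs_neg, abs_of_nonneg (by positivity)]), h₁, h₂, fun hconn => ?_⟩
  -- non-connection: an open annulus path from `(r,0)` stays on the positive segment
  obtain ⟨q, hqs, hqe⟩ := exists_walk_of_mem_openConnIn hω hconn
  -- every vertex `v` of `q` has `v 0 ≥ r`
  have key : ∀ v ∈ q.support, (r : ℤ) ≤ v 0 := by
    -- by induction along the walk: consecutive vertices are joined by an open edge with both
    -- endpoints in the annulus ⊆ B(R), hence an axis edge, hence on the same side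
    suffices h : ∀ (u w : Site 2) (q' : (zdGraph 2).Walk u w), (r : ℤ) ≤ u 0 →
        (∀ z ∈ q'.support, z ∈ sqAnnulus r R) → (∀ e ∈ q'.edges, e ∈ ω) → ∀ v ∈ q'.support, (r : ℤ) ≤ v 0 from
      h _ _ q (by simp) hqs hqe
    intro u w q'
    induction q' with
    | nil => intro hu _ _ v hv; simp at hv; rw [hv]; exact hu
    | @cons a b c hab q'' ih =>
      intro ha hs he v hv
      rw [SimpleGraph.Walk.support_cons, List.mem_cons] at hv
      rcases hv with rfl | hv
      · exact ha
      · -- the first edge is an axis edge: `b` is an axis site with `b 0` of the sign of `a 0`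
        have hab_ω : s(a, b) ∈ ω := he _ (by simp)
        have ha_ann : a ∈ sqAnnulus r R := hs a (by simp)
        have hb_ann : b ∈ sqAnnulus r R := hs b (by simp)
        have hbox : s(a, b) ∈ (box 2 R).sym2 := by
          rw [Finset.mem_sym2_iff]
          intro x hx
          rcases Sym2.mem_iff.1 hx with rfl | rfl
          · exact ((mem_sqAnnulus_iff hr).1 ha_ann).1 |> fun h => mem_box.2 h
          · exact ((mem_sqAnnulus_iff hr).1 hb_ann).1 |> fun h => mem_box.2 h
        have hb_axis : b ∈ axisSites r R := hclosed _ hbox hab_ω b (Sym2.mem_mk_right _ _)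
        have ha_axis : a ∈ axisSites r R := hclosed _ hbox hab_ω a (Sym2.mem_mk_left _ _)
        have hb0 : (r : ℤ) ≤ b 0 := by
          -- `|a 0 - b 0| ≤ 1`, `r ≤ a 0`, `r ≤ |b 0|`, `r ≥ 1`
          have hd : |a 0 - b 0| ≤ 1 := by
            have := zdGraph_adj_apply_le hab 0
            rw [abs_le]; constructor <;> linarith [this.1, this.2]
          have hb := hb_axis.2.1
          rcases le_abs'.1 hb with h | h
          · exfalso
            have := abs_le.1 hd
            have hr1 : (1 : ℤ) ≤ r := by exact_mod_cast hr
            linarith [this.1, this.2]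
          · exact h
        exact ih hb0 (fun z hz => hs z (by simp [hz])) (fun e he' => he e (by simp [he'])) v hv
  have := key _ q.end_mem_support
  simp [pt] at this
  have hr1 : (1 : ℤ) ≤ r := by exact_mod_cast hr
  linarith

/-- **The alternating four-arm event has positive probability**: `P_{1/2}(fourArmTwoClusters r R) > 0`
for `1 ≤ r ≤ R` — so Schramm–Steif's proviso "if `P[A_j(r,2r)] > 0`" is met for every `r ≥ 1`
in this rendering. [folklore] -/
theorem real_fourArmTwoClusters_pos {r R : ℕ} (hr : 1 ≤ r) (hrR : r ≤ R) :
    0 < (bondPercolation (zdGraph 2) half).real (fourArmTwoClusters r R) := by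
  set P := bondPercolation (zdGraph 2) half with hP
  set Fo : Finset (Sym2 (Site 2)) := posAxisEdges r R ∪ negAxisEdges r R with hFo
  set Fc : Finset (Sym2 (Site 2)) := ((box 2 R).sym2).filter fun e => ¬ ∀ x ∈ e, x ∈ axisSites r R
    with hFc
  set A : Set (BondConfig (Site 2)) := {ω | (↑Fo : Set (Sym2 (Site 2))) ⊆ ω} with hA
  set B : Set (BondConfig (Site 2)) := {ω | ∀ e ∈ Fc, e ∉ ω} with hB
  have hFoE : (↑Fo : Set (Sym2 (Site 2))) ⊆ (zdGraph 2).edgeSet := by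
    rw [hFo, Finset.coe_union]
    exact union_subset (posAxisEdges_subset_edgeSet r R) (negAxisEdges_subset_edgeSet r R)
  -- the axis edges have all their endpoints on the axis, so `Fo` and `Fc` are disjoint
  have hFo_axis : ∀ e ∈ Fo, ∀ x ∈ e, x ∈ axisSites r R := by
    intro e he x hx
    rw [hFo, Finset.mem_union] at he
    rcases he with he | he
    · simp only [posAxisEdges, Finset.mem_image, Finset.mem_Ico] at he
      obtain ⟨i, ⟨hi1, hi2⟩, rfl⟩ := he
      rcases Sym2.mem_iff.1 hx with rfl | rfl
      · refine (pt_mem_axisSites_iff _).2 ⟨?_, ?_⟩ <;> rw [abs_of_nonneg (by positivity)] <;>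
          exact_mod_cast (by omega)
      · refine (pt_mem_axisSites_iff _).2 ⟨?_, ?_⟩ <;> rw [abs_of_nonneg (by positivity)] <;>
          exact_mod_cast (by omega)
    · simp only [negAxisEdges, Finset.mem_image, Finset.mem_Ico] at he
      obtain ⟨i, ⟨hi1, hi2⟩, rfl⟩ := he
      rcases Sym2.mem_iff.1 hx with rfl | rfl
      · refine (pt_mem_axisSites_iff _).2 ⟨?_, ?_⟩ <;> rw [abs_neg, abs_of_nonneg (by positivity)] <;>
          exact_mod_cast (by omega)
      · refine (pt_mem_axisSites_iff _).2 ⟨?_, ?_⟩ <;> rw [abs_neg, abs_of_nonneg (by positivity)] <;>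
          exact_mod_cast (by omega)
  have hdisj : Disjoint (↑Fo : Set (Sym2 (Site 2))) ↑Fc := by
    rw [Set.disjoint_left]
    intro e heo hec
    rw [Finset.mem_coe, hFc, Finset.mem_filter] at hec
    exact hec.2 (hFo_axis e heo)
  -- `A ∩ B ⊆ fourArmTwoClusters` on lattice configurations
  have hincl : ∀ ω : BondConfig (Site 2), ω ⊆ (zdGraph 2).edgeSet → ω ∈ A ∩ B → ω ∈ fourArmTwoClusters r R := by
    rintro ω hω ⟨hA', hB'⟩
    refine mem_fourArmTwoClusters_of_axis hr hrR hω
      ((Finset.coe_subset.2 Finset.subset_union_left).trans hA')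
      ((Finset.coe_subset.2 Finset.subset_union_right).trans hA') fun e he heω => ?_
    by_contra hnot
    exact hB' e (by rw [hFc, Finset.mem_filter]; exact ⟨he, hnot⟩) heω
  -- probabilities
  have hAB : P.real (A ∩ B) = P.real A * P.real B :=
    bondPercolation_real_inter_of_disjoint (zdGraph 2) half hdisj (determinedBy_setOf_subset _)
      (determinedBy_forall_notMem Fc) (measurableSet_setOf_subset (Finset.countable_toSet _))
      (measurableSet_forall_notMem Fc)
  have hApos : 0 < P.real A := by
    rw [hA, bondPercolation_real_setOf_subset _ half Fo hFoE]
    exact pow_pos (by rw [coe_half]; norm_num) _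
  have hBpos : 0 < P.real B := by
    refine lt_of_lt_of_le (pow_pos ?_ _) (le_bondPercolation_real_forall_notMem (zdGraph 2) half Fc)
    rw [coe_half]; norm_num
  have hae : (A ∩ B : Set (BondConfig (Site 2))) ≤ᵐ[P] (fourArmTwoClusters r R : Set (BondConfig (Site 2))) :=
    (ae_subset_edgeSet (zdGraph 2) half).mono fun ω hω h => hincl ω hω h
  calc 0 < P.real A * P.real B := mul_pos hApos hBpos
    _ = P.real (A ∩ B) := hAB.symm
    _ ≤ P.real (fourArmTwoClusters r R) := ENNReal.toReal_mono (measure_ne_top _ _) (measure_mono_ae hae)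

end Positivity

end Literature.Probability.Percolation
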